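import Literature.NumberTheory.EllipticCurves.IwasawaSelmerControlKernelProofs
import Literature.NumberTheory.EllipticCurves.IwasawaSelmerDualProofs
import Literature.NumberTheory.EllipticCurves.GreenbergSelmer
import Literature.NumberTheory.EllipticCurves.GeomPointsGaloisModule
import Literature.NumberTheory.GaloisRepresentations.ContinuousCorestriction
import Literature.NumberTheory.GaloisRepresentations.AbsGaloisGroupCompact
import HarnessLib

/-!
# K6 crux `MuTransferX9` (stmt-BirchSwinnertonDyer-19276), stub `stub_selmerDualOdd` (skeleton v6),
# local condition at `p`, part 2: `ker(H¹(D_v ∩ Γ_n, E[p]) → H¹(D_v ∩ Γ_∞, E[p]))` has order `≤ #E[p]`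

Cell `bsd-smallim`, seat `bsd-smallim-k6-c2` (gen 3). HONEST FRAMING: theorems only (no definition, no named
fact, no `sorry`); nothing asserted about any curve, nothing booked. Architecture (Lp-4b) of the seat's NOTES
toward hypothesis (L-p) of `SelmerDual.stub_selmerDualOdd_of_local`.  For a number field `K`, a `ℤ_p`-extension
`κ` with a topological generator `γ̃` lying in the decomposition group `D_v = GreenbergSelmer.decomp v` and
such that `κ(D_v) = ℤ_p` (the place `v` is TOTALLY RAMIFIED in `K_∞`: every coset of `Gal(K̄/K_∞)` meets
`D_v`), in the currency `decompIn H v = H ∩ D_v ≤ D_v` (`GreenbergSelmer`):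

* `decompIn_mono`, `isCompact_decomp`, `compactSpace_decompIn` — plumbing.
* `decompIn_layer_eq_top_of_isOpen` — **`D_v ∩ Gal(K̄/K_∞)` and `γ̃^{pⁿ}` generate `D_v ∩ Gal(K̄/K_n)`
  topologically**: the local twin of the tree's `ZpExtension.layerSubgroup_eq_top_of_isOpen` (same
  `p`-adic approximation argument, with the surjectivity `κ(D_v) = ℤ_p` in place of `κ(Γ_K) = ℤ_p`).
* `finite_ker_resOfLe_decompIn_and_card_le` — hence, by the tree's GENERIC inflation–restriction embedding
  `ResKernel.finite_subgroupResKer` (`ker res ↪ M^N/(γ−1)M^N`), **the kernel of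
  `res : H¹(D_v ∩ Gal(K̄/K_n), M) → H¹(D_v ∩ Gal(K̄/K_∞), M)` is finite of order `≤ #M`** for every finite
  discrete `Γ_K`-module `M` — uniformly in `n` (Greenberg's Lemma 3.1 at the completely... totally ramified
  place, for `p`-torsion coefficients).
* `natCard_comap_le_mul` — `#(f⁻¹ S) ≤ #ker f · #S` (counting; used in part 3 with `S` the local Kummer kernel).

PARTITION (D-0054): X9 (A4) × p ∈ {5,7} (+ X10b∧¬Surj at 3) — helper toward `stub_selmerDualOdd`; closes none.

References: R. Greenberg, LNM 1716 (1999) §3 Lemma 3.1–3.2 [GreenbergLNM1716]; L. Washington, *Introduction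
to Cyclotomic Fields* (1997) §13.1 [Washington1997]; HOME/koly/MU-TRANSFER-PROOF.md §5 STEP 1.
-/

set_option linter.dupNamespace false
set_option autoImplicit false

noncomputable section

open scoped NumberField
open Field IsDedekindDomain
open Literature.NumberTheory.GaloisRepresentations
open Literature.NumberTheory.EllipticCurves
open Literature.NumberTheory.EllipticCurves.GreenbergSelmer

universe u

namespace Summit.BirchSwinnertonDyer.BirchSwinnertonDyer.Rank1Residual.SelmerDual

/-! ## Counting -/

section Counting

/-- `#(f⁻¹ S) ≤ #ker f · #S` for an additive map `f` and a subgroup `S` with `ker f` and `S` finite; and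
`f⁻¹ S` is then finite. [folklore] -/
theorem natCard_comap_le_mul {A B : Type*} [AddCommGroup A] [AddCommGroup B] (f : A →+ B)
    (S : AddSubgroup B) [Finite f.ker] [Finite S] :
    Finite (S.comap f) ∧ Nat.card (S.comap f) ≤ Nat.card f.ker * Nat.card S := by
  -- `f` restricted to `f⁻¹ S → S`
  let g : S.comap f →+ S := (f.comp (S.comap f).subtype).codRestrict S fun x => x.2
  let i : g.ker → f.ker := fun x => ⟨((x : S.comap f) : A), by
    have hx := x.2
    rw [AddMonoidHom.mem_ker] at hx ⊢
    exact congrArg Subtype.val hx⟩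
  have hi : Function.Injective i := fun x y hxy =>
    Subtype.ext (Subtype.ext (by simpa [i] using congrArg Subtype.val hxy))
  haveI : Finite g.ker := Finite.of_injective i hi
  have hker : Nat.card g.ker ≤ Nat.card f.ker := Nat.card_le_card_of_injective i hi
  have hrange : Nat.card g.range ≤ Nat.card S := Nat.card_le_card_of_injective _ Subtype.val_injective
  have hcard : Nat.card (S.comap f) = Nat.card g.ker * Nat.card g.range := by
    rw [← Nat.card_congr (QuotientAddGroup.quotientKerEquivRange g).toEquiv, mul_comm,
      ← AddSubgroup.card_eq_card_quotient_mul_card_addSubgroup]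
  have hle : Nat.card (S.comap f) ≤ Nat.card f.ker * Nat.card S :=
    hcard ▸ Nat.mul_le_mul hker hrange
  refine ⟨Nat.finite_of_card_ne_zero (fun h0 => ?_), hle⟩
  rw [hcard, mul_eq_zero] at h0
  rcases h0 with h0 | h0
  · exact (Nat.card_pos (α := g.ker)).ne' h0
  · haveI : Finite g.range := Finite.of_injective _ Subtype.val_injective
    exact (Nat.card_pos (α := g.range)).ne' h0

end Counting

/-! ## The local groups `D_v ∩ H` -/

section Local

variable {K : Type u} [Field K] [NumberField K] (v : HeightOneSpectrum (𝓞 K))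

/-- `decompIn` is monotone in `H`. [cite: Greenberg1989, §1 p. 98] -/
theorem decompIn_mono {H H' : Subgroup (absoluteGaloisGroup K)} (h : H ≤ H') :
    decompIn H v ≤ decompIn H' v := fun x hx => by
  rw [mem_decompIn_iff] at hx ⊢
  exact h hx

/-- `D_v` is compact (continuous image of the compact `Γ_{K_v}`). [cite: NeukirchANT1999, Ch. II §9 Prop. (9.6)] -/
theorem isCompact_decomp : IsCompact ((decomp v : Subgroup (absoluteGaloisGroup K)) : Set (absoluteGaloisGroup K)) := by
  haveI : CompactSpace (absoluteGaloisGroup (v.adicCompletion K)) := absoluteGaloisGroup_compactSpace _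
  exact isCompact_range (absGaloisRestrict K (v.adicCompletion K)).continuous

/-- `D_v ∩ H` is compact for `H` closed. [cite: NeukirchANT1999, Ch. II §9 Prop. (9.6)] -/
theorem compactSpace_decompIn {H : Subgroup (absoluteGaloisGroup K)} (hH : IsClosed (H : Set (absoluteGaloisGroup K))) :
    CompactSpace (decompIn H v) := by
  haveI : CompactSpace (decomp v) := isCompact_iff_compactSpace.mp (isCompact_decomp v)
  have hcl : IsClosed ((decompIn H v : Subgroup (decomp v)) : Set (decomp v)) := by
    have : ((decompIn H v : Subgroup (decomp v)) : Set (decomp v)) = Subtype.val ⁻¹' (H : Set _) := by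
      ext x; exact mem_decompIn_iff H v x
    rw [this]
    exact hH.preimage continuous_subtype_val
  exact isCompact_iff_compactSpace.mp hcl.isCompact

end Local

/-! ## `D_v ∩ Gal(K̄/K_∞)` and `γ̃^{pⁿ}` generate `D_v ∩ Gal(K̄/K_n)` at a totally ramified place -/

section Generation

variable {K : Type u} [Field K] [NumberField K] {p : ℕ} [Fact p.Prime] (κ : ZpExtension K p)
  (v : HeightOneSpectrum (𝓞 K)) {γ : absoluteGaloisGroup K}

/-- **Topological generation at a totally ramified place.** Let `γ̃ ∈ D_v` with `κ γ̃ = 1` and assume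
`κ(D_v) = ℤ_p` (`hsurj`: every coset of `Gal(K̄/K_∞)` meets `D_v`). Then an open subgroup of
`D_v ∩ Gal(K̄/K_n)` containing `D_v ∩ Gal(K̄/K_∞)` and `γ̃^{pⁿ}` is everything (as in the tree's global
`layerSubgroup_eq_top_of_isOpen`: `κ(U) ⊇ pⁿℤ·1 + p^{n+a}ℤ_p = pⁿℤ_p`). [cite: Washington1997, §13.1]
[cite: GreenbergLNM1716, §3 Lemma 3.2] -/
theorem decompIn_layer_eq_top_of_isOpen (hγ : κ.IsTopGenerator γ) (hγD : γ ∈ decomp v)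
    (hsurj : ∀ g : absoluteGaloisGroup K, ∃ d ∈ decomp v, d⁻¹ * g ∈ κ.kerSubgroup) (n : ℕ)
    (U : Subgroup (decompIn (κ.layerSubgroup n) v))
    (hU : IsOpen (U : Set (decompIn (κ.layerSubgroup n) v)))
    (hN : (decompIn κ.kerSubgroup v).subgroupOf (decompIn (κ.layerSubgroup n) v) ≤ U)
    (hγU : (⟨⟨γ ^ p ^ n, Subgroup.pow_mem _ hγD _⟩,
      (mem_decompIn_iff _ v _).2 (κ.pow_mem_layerSubgroup hγ n)⟩ : decompIn (κ.layerSubgroup n) v) ∈ U) :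
    U = ⊤ := by
  haveI : CompactSpace (decompIn (κ.layerSubgroup n) v) :=
    compactSpace_decompIn v ((κ.layerSubgroup n).isClosed_of_isOpen (κ.isOpen_layerSubgroup n))
  haveI : Finite (decompIn (κ.layerSubgroup n) v ⧸ U) := Subgroup.quotient_finite_of_isOpen _ hU
  haveI : U.FiniteIndex := Subgroup.finiteIndex_of_finite_quotient
  set V := U.normalCore with hV
  haveI : V.FiniteIndex := inferInstance
  have hVU : V ≤ U := Subgroup.normalCore_le U
  have hd : V.index ≠ 0 := Subgroup.FiniteIndex.index_ne_zero
  obtain ⟨a, e, he, hde⟩ := Nat.exists_eq_pow_mul_and_not_dvd hd p (Fact.out : p.Prime).ne_one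
  obtain ⟨u, hu⟩ := IwasawaDual.isUnit_natCast_padicInt (p := p) he
  have hγ' : κ γ = Multiplicative.ofAdd 1 := hγ
  have hcoe : ∀ (w : decompIn (κ.layerSubgroup n) v) (k : ℕ),
      (((w ^ k : decompIn (κ.layerSubgroup n) v) : decomp v) : absoluteGaloisGroup K) =
        ((w : decomp v) : absoluteGaloisGroup K) ^ k := fun w k => by simp
  rw [eq_top_iff]
  rintro x -
  have hx : ((x : decomp v) : absoluteGaloisGroup K) ∈ κ.layerSubgroup n :=
    (mem_decompIn_iff _ v _).1 x.2
  obtain ⟨z, hz⟩ := ZpExtension.mem_layerSubgroup.mp hx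
  -- `z = c + p^a y`
  obtain ⟨y, hy⟩ := Ideal.mem_span_singleton.mp (PadicInt.appr_spec a z)
  -- `g₀ ∈ D_v ∩ Gal(K̄/K_n)` with `κ g₀ = u⁻¹ pⁿ y` (total ramification)
  obtain ⟨g, hg⟩ := κ.surjective
    (Multiplicative.ofAdd (((u⁻¹ : ℤ_[p]ˣ) : ℤ_[p]) * ((p : ℤ_[p]) ^ n * y)))
  obtain ⟨d, hdD, hdg⟩ := hsurj g
  have hκd : κ d = Multiplicative.ofAdd (((u⁻¹ : ℤ_[p]ˣ) : ℤ_[p]) * ((p : ℤ_[p]) ^ n * y)) := by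
    have h1 : κ (d⁻¹ * g) = 1 := hdg
    rw [map_mul, map_inv, inv_mul_eq_one] at h1
    exact h1.trans hg
  have hdn : d ∈ κ.layerSubgroup n := by
    rw [ZpExtension.mem_layerSubgroup, hκd, toAdd_ofAdd]
    exact ⟨((u⁻¹ : ℤ_[p]ˣ) : ℤ_[p]) * y, by ring⟩
  let g₀ : decompIn (κ.layerSubgroup n) v := ⟨⟨d, hdD⟩, (mem_decompIn_iff _ v _).2 hdn⟩
  have hκ₀ : (κ (((g₀ ^ V.index : decompIn (κ.layerSubgroup n) v) : decomp v) :
      absoluteGaloisGroup K)).toAdd = (p : ℤ_[p]) ^ n * ((p : ℤ_[p]) ^ a * y) := by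
    rw [hcoe, map_pow, show κ (((g₀ : decompIn (κ.layerSubgroup n) v) : decomp v) :
      absoluteGaloisGroup K) = _ from hκd, ← ofAdd_nsmul, toAdd_ofAdd, nsmul_eq_mul, hde, Nat.cast_mul,
      Nat.cast_pow, ← hu, mul_assoc, ← mul_assoc (u : ℤ_[p]), Units.mul_inv, one_mul]
    ring
  set q : decompIn (κ.layerSubgroup n) v := ⟨⟨γ ^ p ^ n, Subgroup.pow_mem _ hγD _⟩,
      (mem_decompIn_iff _ v _).2 (κ.pow_mem_layerSubgroup hγ n)⟩ with hq
  have hκγ1 : κ (γ ^ p ^ n) = Multiplicative.ofAdd ((p : ℤ_[p]) ^ n) := by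
    rw [map_pow, hγ', ← ofAdd_nsmul, nsmul_eq_mul, mul_one, Nat.cast_pow]
  have hκγ : (κ (((q ^ z.appr a : decompIn (κ.layerSubgroup n) v) : decomp v) :
      absoluteGaloisGroup K)).toAdd = (p : ℤ_[p]) ^ n * (z.appr a : ℤ_[p]) := by
    rw [hcoe, map_pow, show κ (((q : decompIn (κ.layerSubgroup n) v) : decomp v) :
      absoluteGaloisGroup K) = _ from hκγ1, ← ofAdd_nsmul, toAdd_ofAdd, nsmul_eq_mul, mul_comm]
  set u₁ : decompIn (κ.layerSubgroup n) v := q ^ z.appr a * g₀ ^ V.index with hu₁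
  have hu₁U : u₁ ∈ U := U.mul_mem (U.pow_mem hγU _) (hVU (V.pow_index_mem g₀))
  have hz' := hz
  rw [sub_eq_iff_eq_add'.mp hy] at hz'
  have hκu₁ : (κ ((u₁ : decomp v) : absoluteGaloisGroup K)).toAdd =
      (κ ((x : decomp v) : absoluteGaloisGroup K)).toAdd := by
    rw [hu₁, Subgroup.coe_mul, Subgroup.coe_mul, map_mul, toAdd_mul, hκγ, hκ₀, hz']
    ring
  have hmem : u₁⁻¹ * x ∈ (decompIn κ.kerSubgroup v).subgroupOf (decompIn (κ.layerSubgroup n) v) := by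
    rw [Subgroup.mem_subgroupOf, mem_decompIn_iff, ZpExtension.mem_kerSubgroup, Subgroup.coe_mul,
      Subgroup.coe_inv, Subgroup.coe_mul, Subgroup.coe_inv, map_mul, map_inv]
    apply Multiplicative.toAdd.injective
    rw [toAdd_mul, toAdd_inv, hκu₁, toAdd_one, neg_add_cancel]
  have := U.mul_mem hu₁U (hN hmem)
  rwa [mul_inv_cancel_left] at this

/-- `D_v ∩ H` is normal in `D_v` for `H ⊴ Γ_K` (local copy of part 1's `decompIn_normal`).
[cite: Greenberg1989, §1 p. 98] -/
theorem decompIn_normal' (H : Subgroup (absoluteGaloisGroup K)) [hH : H.Normal] : (decompIn H v).Normal :=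
  ⟨fun x hx g => by
    rw [mem_decompIn_iff] at hx ⊢
    push_cast
    exact hH.conj_mem _ hx _⟩

/-- **The inflation kernel at a totally ramified place has order `≤ #M`, uniformly in the layer.** For a
finite discrete `Γ_K`-module `M` (continuous orbit maps), a topological generator `γ̃ ∈ D_v` of `κ` and
`κ(D_v) = ℤ_p`: the kernel of `res : H¹(D_v ∩ Gal(K̄/K_n), M) → H¹(D_v ∩ Gal(K̄/K_∞), M)` is finite of
order `≤ #M` — it embeds into `M^{D_v ∩ Gal(K̄/K_∞)}/(γ̃^{pⁿ} − 1)` by the tree's generic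
`ResKernel.finite_subgroupResKer` (Greenberg's Lemma 3.1 argument), the generation hypothesis being
`decompIn_layer_eq_top_of_isOpen`. [cite: GreenbergLNM1716, §3 Lemma 3.1] -/
theorem finite_ker_resOfLe_decompIn_and_card_le {M : Type u} [AddCommGroup M]
    [DistribMulAction (absoluteGaloisGroup K) M] [TopologicalSpace M] [DiscreteTopology M] [Finite M]
    (hcont : ∀ m : M, Continuous fun g : absoluteGaloisGroup K => g • m)
    (hγ : κ.IsTopGenerator γ) (hγD : γ ∈ decomp v)
    (hsurj : ∀ g : absoluteGaloisGroup K, ∃ d ∈ decomp v, d⁻¹ * g ∈ κ.kerSubgroup) (n : ℕ) :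
    Finite (resOfLe M (decompIn_mono v (κ.kerSubgroup_le_layerSubgroup n))).ker ∧
      Nat.card (resOfLe M (decompIn_mono v (κ.kerSubgroup_le_layerSubgroup n))).ker ≤ Nat.card M := by
  have h := decompIn_mono v (κ.kerSubgroup_le_layerSubgroup n)
  haveI : (decompIn κ.kerSubgroup v).Normal := decompIn_normal' v κ.kerSubgroup
  -- the generic embedding `ker res ↪ M^N/(q − 1)M^N` for `G = D_v ∩ Gal(K̄/K_n)`, `N = D_v ∩ Gal(K̄/K_∞)`
  set N : Subgroup (decompIn (κ.layerSubgroup n) v) :=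
    (decompIn κ.kerSubgroup v).subgroupOf (decompIn (κ.layerSubgroup n) v) with hNdef
  let q : decompIn (κ.layerSubgroup n) v := ⟨⟨γ ^ p ^ n, Subgroup.pow_mem _ hγD _⟩,
      (mem_decompIn_iff _ v _).2 (κ.pow_mem_layerSubgroup hγ n)⟩
  have hgen : ∀ U : Subgroup (decompIn (κ.layerSubgroup n) v),
      IsOpen (U : Set (decompIn (κ.layerSubgroup n) v)) → N ≤ U → q ∈ U → U = ⊤ :=
    fun U hU hNU hqU => decompIn_layer_eq_top_of_isOpen κ v hγ hγD hsurj n U hU hNU hqU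
  have hcont' : ∀ m : M, Continuous fun g : decompIn (κ.layerSubgroup n) v => g • m := fun m =>
    (hcont m).comp (continuous_subtype_val.comp continuous_subtype_val)
  obtain ⟨hfin, hle⟩ := ResKernel.finite_subgroupResKer N M q hgen hcont'
  -- `ker (resOfLe h) ≤ subgroupResKer M N` (`res_N = (tautological iso)^* ∘ res_h`)
  have hfac : ResKernel.resSubgroup N M =
      (resH1Hom (subgroupOfHom h) (AddMonoidHom.id M) (fun _ _ => rfl)).comp (resOfLe M h) := by
    rw [ResKernel.resSubgroup, resOfLe, resH1Hom_comp]
    exact resH1Hom_congr (ContinuousMonoidHom.ext fun _ => rfl) rfl _ _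
  have hsub : (resOfLe M h).ker ≤ subgroupResKer M N := fun c hc => by
    rw [ResKernel.mem_subgroupResKer_iff, hfac, AddMonoidHom.comp_apply, (AddMonoidHom.mem_ker).mp hc,
      map_zero]
  have hinj := AddSubgroup.inclusion_injective hsub
  haveI : Finite (resOfLe M h).ker := Finite.of_injective _ hinj
  refine ⟨inferInstance, (Nat.card_le_card_of_injective _ hinj).trans (hle.trans ?_)⟩
  exact (Nat.card_le_card_of_surjective _ (QuotientAddGroup.mk'_surjective _)).trans
    (Nat.card_le_card_of_injective _ Subtype.val_injective)

end Generation

end Summit.BirchSwinnertonDyer.BirchSwinnertonDyer.Rank1Residual.SelmerDual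

end
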